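import Mathlib
import Literature.NumberTheory.LFunctions.Zhang2022.Section17SummedError
import Literature.NumberTheory.LFunctions.Zhang2022.Section17KappaTwoSums
import Literature.NumberTheory.LFunctions.Zhang2022.TypedSection17Identities
import Literature.NumberTheory.LFunctions.Zhang2022.Section15Bcoef
import HarnessLib

/-!
# Zhang (2022) §17.u021 (χ-reading): the dropped terms with `(m₁,𝔮) > 1` are `o(1)` —
# the remainder `R₂` of `Typed.Section17.step17_u021Chi_of_remainders`, PROVED

Topic `Literature/NumberTheory/LFunctions/Zhang2022` (Landau–Siegel audit tree; verdict-neutral).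
Y. Zhang, *Discrete mean estimates and the Landau–Siegel zero*, arXiv:2211.02515v1 (2022)
[Zhang2022LandauSiegel] — **an unrefereed manuscript under adjudication**; nothing here asserts or denies
its Theorems 1–2. §17 p. 98 (tex L4823–L4827; DAG `Z22:§17.u021`, node of record
`Typed.Section17.Step17_u021Chi`, RT16-int-1): "On the right side above, we can drop the terms with
`m₂ > 1` or `(m₁,𝔮) > 1` with an acceptable error." The tree's `Typed.Section17.step17_u021Chi_of_remainders`
(`Section17U021ChiDecomposition`) reduces the node to two remainder estimates `R₁` (`m₂ ≥ 2`) and `R₂`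
(`m₂ = 1`, `(m₁,𝔮) > 1`). THIS FILE PROVES the `R₂` estimate — `step17_u021Chi_R2_holds`, the hypothesis
`hR₂` VERBATIM — unconditionally (no use of (A), no relative budget):

* the series over `m₁` is a finite sum (`b(l₁m₁) = 0` for `m₁ ≥ ⌈P⌉`, (15.2)) and, termwise,
  `|b(l₁m₁)χ(l₁m₁)ν₁*(l₂)κ̄₂(m₁)/m₁| ≤ C_b·|ν₁*(l₂)|·τ₂(l₁m₁)|κ₂(m₁)|/m₁` (`|b| ≤ C_bτ₂`, `κ̄₂ = κ₂[−b₁]`);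
* `Σ_{m≤⌈P⌉, (m,𝔮)>1} τ₂(l₁m)|κ₂(m)|/m ≤ τ₂(l₁)·2|b₁|(log D⁴ + log 4)·exp(1 + 2|b₁|(log⌈P⌉ + log 4) + S₂)`
  (`Section17KappaTwoSums.sum_notCoprime_tau_kappa_le`: `|κ₂(q^c)| ≤ |b₁|log q` independently of `c`, one
  prime `q < D⁴` removed, Hall–Tenenbaum + Mertens), and `|b₁| ≤ 2α`, `α log P = π`, so this is
  `≤ K·α𝓛·τ₂(l₁)` with an absolute `K`;
* hence `|R₂| ≤ K′·α𝓛·Σ_{l<D⁴}(|ν(l)|/l)Σ_{l=l₁l₂}τ₂(l₁)|ν₁*(l₂)|`, the summed-error quantity of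
  `Phi3Eval.step17_hE_holds` (`Section17SummedError`, `≪ 𝓛⁻⁴`), which is `≤ ε` eventually.

Theorems only (no definitions, no named facts); axioms standard. The companion remainder `R₁` (`m₂ ≥ 2`)
is NOT treated here. WHAT THIS IS NOT: any claim about Theorems 1–2 of the source or about Landau–Siegel
zeros; nothing here bears on the cell's verdict on (8.24).

## References

* Y. Zhang, arXiv:2211.02515v1 (2022), §17 p. 98 (u020–u021); §16 p. 89 (`κ₂`); §15 (15.2).
  [cite: Zhang2022LandauSiegel, §17 u021 p.98]
-/

noncomputable section

open Complex Real Finset ArithmeticFunction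
open Literature.NumberTheory.LFunctions.Zhang2022.Skeleton
open Literature.NumberTheory.LFunctions.Zhang2022.Typed.Section17
open Literature.NumberTheory.LFunctions.Zhang2022.MeanSquareMajorant

namespace Literature.NumberTheory.LFunctions.Zhang2022.Phi3Eval

variable {D : ℕ} (χ : DirichletCharacter ℂ D)

/-- The `R₂` series over `m₁` is a finite sum over `1 ≤ m₁ < ⌈P⌉` (`b(l₁m₁) = 0` for `m₁ ≥ ⌈P⌉ ≥ PT⁻²`,
(15.2); the `m₁ = 0` term is `…/0 = 0`). [cite: Zhang2022LandauSiegel, §15 (15.2) p.79] -/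
theorem tsum_R2_eq_sum (c' : ℝ) (hℓ : 3 ≤ ell D) {l₁ : ℕ} (h1 : 1 ≤ l₁) (l₂ : ℕ) :
    (∑' m₁ : ℕ, if ¬ Nat.Coprime m₁ (frakq D) then
        bcoef D (l₁ * m₁) * χ ((l₁ * m₁ : ℕ) : ZMod D) * nuOneStar c' χ l₂ *
          kappa2bar c' D m₁ / (m₁ : ℂ) else 0) =
      ∑ m₁ ∈ Finset.Ico 1 ⌈bigP D⌉₊, if ¬ Nat.Coprime m₁ (frakq D) then
        bcoef D (l₁ * m₁) * χ ((l₁ * m₁ : ℕ) : ZMod D) * nuOneStar c' χ l₂ *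
          kappa2bar c' D m₁ / (m₁ : ℂ) else 0 := by
  classical
  refine tsum_eq_sum fun m hm => ?_
  rw [Finset.mem_Ico, not_and_or, not_le, not_lt] at hm
  rcases hm with hm | hm
  · have hm0 : m = 0 := by omega
    subst hm0
    simp
  · have hT1 : 1 ≤ bigT D := Real.one_le_exp (by positivity)
    have hP0 : 0 ≤ bigP D := (Real.exp_pos _).le
    have hb : bcoef D (l₁ * m) = 0 := by
      refine bcoef_eq_zero_of_le hℓ ?_
      calc bigP D / bigT D ^ 2 ≤ bigP D := by
            rw [div_le_iff₀ (by positivity)]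
            nlinarith [one_le_pow₀ (M₀ := ℝ) hT1 (n := 2)]
        _ ≤ ⌈bigP D⌉₊ := Nat.le_ceil _
        _ ≤ m := by exact_mod_cast hm
        _ ≤ ((l₁ * m : ℕ) : ℝ) := by exact_mod_cast Nat.le_mul_of_pos_left m h1
    simp [hb]

/-- Termwise bound for the `R₂` series: for `1 ≤ l₁` and `𝓛 ≥ 3`,
`‖Σ'_{(m₁,𝔮)>1} b(l₁m₁)χ(l₁m₁)ν₁*(l₂)κ̄₂(m₁)/m₁‖ ≤ C_b‖ν₁*(l₂)‖·Σ_{m≤⌈P⌉,(m,𝔮)>1} τ₂(l₁m)|κ₂[−b₁](m)|/m`.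
[cite: Zhang2022LandauSiegel, §17 u021 p.98] -/
theorem norm_tsum_R2_le (c' : ℝ) (hℓ : 3 ≤ ell D) {l₁ : ℕ} (h1 : 1 ≤ l₁) (l₂ : ℕ) :
    ‖∑' m₁ : ℕ, if ¬ Nat.Coprime m₁ (frakq D) then
        bcoef D (l₁ * m₁) * χ ((l₁ * m₁ : ℕ) : ZMod D) * nuOneStar c' χ l₂ *
          kappa2bar c' D m₁ / (m₁ : ℂ) else 0‖ ≤
      (1 + ‖iota2‖) * (‖iota3‖ + ‖iota4‖) * ‖nuOneStar c' χ l₂‖ *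
        ∑ m ∈ (Icc 1 ⌈bigP D⌉₊).filter (fun m => ¬ Nat.Coprime m (frakq D)),
          tau 2 (l₁ * m) * ‖kappa₂ (-(b1 c' D)) m‖ / m := by
  classical
  have hD2 : 2 ≤ Real.log D := by rw [← ell]; linarith
  set Cb : ℝ := (1 + ‖iota2‖) * (‖iota3‖ + ‖iota4‖) with hCb
  have hCb0 : 0 ≤ Cb := by positivity
  rw [tsum_R2_eq_sum χ c' hℓ h1 l₂]
  refine (norm_sum_le _ _).trans ?_
  -- pass to the filtered sum over `Icc 1 ⌈P⌉ ⊇ Ico 1 ⌈P⌉`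
  have hsub : Finset.Ico 1 ⌈bigP D⌉₊ ⊆ Icc 1 ⌈bigP D⌉₊ := fun m hm => by
    rw [Finset.mem_Ico] at hm; rw [Finset.mem_Icc]; omega
  calc ∑ m ∈ Finset.Ico 1 ⌈bigP D⌉₊, ‖if ¬ Nat.Coprime m (frakq D) then
          bcoef D (l₁ * m) * χ ((l₁ * m : ℕ) : ZMod D) * nuOneStar c' χ l₂ * kappa2bar c' D m / (m : ℂ)
          else 0‖
      = ∑ m ∈ Finset.Ico 1 ⌈bigP D⌉₊, (if ¬ Nat.Coprime m (frakq D) then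
          ‖bcoef D (l₁ * m) * χ ((l₁ * m : ℕ) : ZMod D) * nuOneStar c' χ l₂ * kappa2bar c' D m / (m : ℂ)‖
          else 0) := Finset.sum_congr rfl fun m _ => by split_ifs <;> simp
    _ = ∑ m ∈ (Finset.Ico 1 ⌈bigP D⌉₊).filter (fun m => ¬ Nat.Coprime m (frakq D)),
          ‖bcoef D (l₁ * m) * χ ((l₁ * m : ℕ) : ZMod D) * nuOneStar c' χ l₂ * kappa2bar c' D m / (m : ℂ)‖ := by
        rw [Finset.sum_filter]
    _ ≤ ∑ m ∈ (Icc 1 ⌈bigP D⌉₊).filter (fun m => ¬ Nat.Coprime m (frakq D)),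
          ‖bcoef D (l₁ * m) * χ ((l₁ * m : ℕ) : ZMod D) * nuOneStar c' χ l₂ * kappa2bar c' D m / (m : ℂ)‖ :=
        Finset.sum_le_sum_of_subset_of_nonneg (Finset.filter_subset_filter _ hsub) fun _ _ _ => norm_nonneg _
    _ ≤ ∑ m ∈ (Icc 1 ⌈bigP D⌉₊).filter (fun m => ¬ Nat.Coprime m (frakq D)),
          Cb * ‖nuOneStar c' χ l₂‖ * (tau 2 (l₁ * m) * ‖kappa₂ (-(b1 c' D)) m‖ / m) := by
        refine Finset.sum_le_sum fun m hm => ?_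
        have hm1 : 1 ≤ m := (Finset.mem_Icc.1 (Finset.mem_filter.1 hm).1).1
        have hm0 : (0 : ℝ) < m := by exact_mod_cast hm1
        rw [norm_div, norm_mul, norm_mul, norm_mul, Complex.norm_natCast, kappa2bar_eq_kappa₂_neg]
        have hb := norm_bcoef_le hD2 (l₁ * m)
        have hχ := χ.norm_le_one ((l₁ * m : ℕ) : ZMod D)
        have hτ : 0 ≤ tau 2 (l₁ * m) := tau_nonneg _ _
        rw [div_le_iff₀ hm0]
        have e : Cb * ‖nuOneStar c' χ l₂‖ * (tau 2 (l₁ * m) * ‖kappa₂ (-(b1 c' D)) m‖ / m) * m =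
            (Cb * tau 2 (l₁ * m)) * 1 * ‖nuOneStar c' χ l₂‖ * ‖kappa₂ (-(b1 c' D)) m‖ := by
          field_simp
        rw [e]
        gcongr
    _ = Cb * ‖nuOneStar c' χ l₂‖ * ∑ m ∈ (Icc 1 ⌈bigP D⌉₊).filter (fun m => ¬ Nat.Coprime m (frakq D)),
          tau 2 (l₁ * m) * ‖kappa₂ (-(b1 c' D)) m‖ / m := by rw [Finset.mul_sum]

/-- The sizes: for `𝓛 ≥ 3` and `|c′α𝓛| ≤ 1/14`, `|b₁| ≤ 2α`, `2|b₁|(log D⁴ + log 4) ≤ 24α𝓛` and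
`2|b₁|(log⌈P⌉ + log 4) ≤ 4π + 16`. [cite: Zhang2022LandauSiegel, §2 (2.13)] -/
theorem b1_size_bounds (c' : ℝ) (hℓ : 3 ≤ ell D) (hc : |c' * alpha D * ell D| ≤ 1 / 14) :
    |-(b1 c' D)| ≤ 2 * alpha D ∧
      2 * |-(b1 c' D)| * (Real.log ((D ^ 4 : ℕ) : ℝ) + Real.log 4) ≤ 24 * (alpha D * ell D) ∧
      2 * |-(b1 c' D)| * (Real.log (⌈bigP D⌉₊ : ℝ) + Real.log 4) ≤ 4 * Real.pi + 16 := by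
  have hℓ0 : 0 < ell D := by linarith
  have hπ := Real.pi_pos
  have hα0 : 0 < alpha D := alpha_pos' hℓ0
  have hα : alpha D = Real.pi / ell D ^ 9 := by rw [alpha, bigP, Real.log_exp]
  have hαℓ9 : alpha D * ell D ^ 9 = Real.pi := by rw [hα]; field_simp
  have hα1 : alpha D ≤ 1 := by
    rw [hα, div_le_one (by positivity)]
    calc Real.pi ≤ 4 := Real.pi_le_four
      _ ≤ 3 ^ 9 := by norm_num
      _ ≤ ell D ^ 9 := pow_le_pow_left₀ (by norm_num) hℓ 9
  have hb : |-(b1 c' D)| ≤ 2 * alpha D := by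
    rw [abs_neg, b1, abs_mul, abs_of_pos hα0]
    have h5 : |1 - 5 * c' * alpha D * ell D| ≤ 2 := by
      have e : 5 * c' * alpha D * ell D = 5 * (c' * alpha D * ell D) := by ring
      rw [e]
      have := abs_le.1 hc
      rw [abs_le]; constructor <;> linarith [this.1, this.2]
    nlinarith [abs_nonneg (1 - 5 * c' * alpha D * ell D)]
  refine ⟨hb, ?_, ?_⟩
  · have hlogD : Real.log ((D ^ 4 : ℕ) : ℝ) = 4 * ell D := by
      push_cast; rw [Real.log_pow, ell]; ring
    rw [hlogD]
    have hlog4 : Real.log 4 ≤ 3 := by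
      have := Real.log_le_sub_one_of_pos (show (0:ℝ) < 4 by norm_num); linarith
    have h4 : 0 ≤ 4 * ell D + Real.log 4 := by
      have := Real.log_nonneg (show (1:ℝ) ≤ 4 by norm_num); positivity
    calc 2 * |-(b1 c' D)| * (4 * ell D + Real.log 4) ≤ 2 * (2 * alpha D) * (4 * ell D + Real.log 4) := by
          gcongr
      _ ≤ 2 * (2 * alpha D) * (4 * ell D + 2 * ell D) := by gcongr; linarith
      _ = 24 * (alpha D * ell D) := by ring
  · have hP0 : 0 < bigP D := Real.exp_pos _
    have hceil : (⌈bigP D⌉₊ : ℝ) ≤ 2 * bigP D := by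
      have h1 : 1 ≤ bigP D := by
        rw [bigP]; exact Real.one_le_exp (by positivity)
      linarith [Nat.ceil_lt_add_one hP0.le]
    have hceil0 : (0 : ℝ) < ⌈bigP D⌉₊ := by
      have : (0 : ℝ) < ⌈bigP D⌉₊ := by exact_mod_cast Nat.ceil_pos.2 hP0
      exact this
    have hlogc : Real.log (⌈bigP D⌉₊ : ℝ) ≤ ell D ^ 9 + Real.log 2 := by
      calc Real.log (⌈bigP D⌉₊ : ℝ) ≤ Real.log (2 * bigP D) := Real.log_le_log hceil0 hceil
        _ = ell D ^ 9 + Real.log 2 := by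
            rw [Real.log_mul (by norm_num) hP0.ne', bigP, Real.log_exp]; ring
    have hlog2 : Real.log 2 ≤ 1 := by
      have := Real.log_le_sub_one_of_pos (show (0:ℝ) < 2 by norm_num); linarith
    have hlog4 : Real.log 4 ≤ 3 := by
      have := Real.log_le_sub_one_of_pos (show (0:ℝ) < 4 by norm_num); linarith
    have hsum0 : 0 ≤ Real.log (⌈bigP D⌉₊ : ℝ) + Real.log 4 := by
      have h1 : (1 : ℝ) ≤ ⌈bigP D⌉₊ := by exact_mod_cast Nat.ceil_pos.2 hP0
      have := Real.log_nonneg h1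
      have := Real.log_nonneg (show (1:ℝ) ≤ 4 by norm_num)
      positivity
    calc 2 * |-(b1 c' D)| * (Real.log (⌈bigP D⌉₊ : ℝ) + Real.log 4)
        ≤ 2 * (2 * alpha D) * (Real.log (⌈bigP D⌉₊ : ℝ) + Real.log 4) := by gcongr
      _ ≤ 2 * (2 * alpha D) * (ell D ^ 9 + 1 + 3) := by gcongr; linarith
      _ = 4 * (alpha D * ell D ^ 9) + 16 * alpha D := by ring
      _ ≤ 4 * Real.pi + 16 := by rw [hαℓ9]; nlinarith

/-- **§17.u021 (χ-reading), remainder `R₂` — the terms with `(m₁,𝔮) > 1` are `o(1)`**: the hypothesis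
`hR₂` of `Typed.Section17.step17_u021Chi_of_remainders` VERBATIM, proved (no use of (A), no relative
budget; rate `≪ 𝓛⁻⁴` from `step17_hE_holds`). [cite: Zhang2022LandauSiegel, §17 u021 p.98] -/
theorem step17_u021Chi_R2_holds (c' : ℝ) : ∀ ε : ℝ, 0 < ε → ForAllLarge fun D _ χ => AssumptionA D χ →
    ‖∑ l ∈ Finset.Ico 1 (D ^ 4), nu χ l / (l : ℂ) *
        ∑ q ∈ l.divisorsAntidiagonal, ∑' m₁ : ℕ,
          if ¬ Nat.Coprime m₁ (frakq D) then
            bcoef D (q.1 * m₁) * χ ((q.1 * m₁ : ℕ) : ZMod D) * nuOneStar c' χ q.2 *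
              kappa2bar c' D m₁ / (m₁ : ℂ)
          else 0‖ ≤ ε := by
  intro ε hε
  set Cb : ℝ := (1 + ‖iota2‖) * (‖iota3‖ + ‖iota4‖) with hCb
  set B₀ : ℝ := Real.exp (1 + (4 * Real.pi + 16) + LogEulerProduct.tailConst 2) with hB₀
  set K : ℝ := Cb * 24 * B₀ + 1 with hK
  have hCb0 : 0 ≤ Cb := by positivity
  have hB₀0 : 0 < B₀ := Real.exp_pos _
  have hK0 : 0 < K := by positivity
  have hεK : 0 < ε / K := div_pos hε hK0
  obtain ⟨D₁, hD₁⟩ := hE_thresholds c' 0 1 one_pos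
  obtain ⟨D₂, hD₂⟩ := step17_hE_holds c' _ hεK
  refine ⟨max D₁ D₂, fun D _ χ hD hq hp hA => ?_⟩
  obtain ⟨hℓ3, hc, -, -, -⟩ := hD₁ D (le_trans (le_max_left _ _) hD)
  have eE := hD₂ D χ (le_trans (le_max_right _ _) hD) hq hp hA
  have hℓ0 : 0 < ell D := by linarith
  have hα0 : 0 < alpha D := alpha_pos' hℓ0
  have hαℓ : 0 ≤ alpha D * ell D := by positivity
  obtain ⟨-, hlogD, hlogP⟩ := b1_size_bounds c' hℓ3 hc
  -- the exponential factor is bounded by `B₀`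
  have hB : Real.exp (1 + 2 * |-(b1 c' D)| * (Real.log (⌈bigP D⌉₊ : ℝ) + Real.log 4) +
      LogEulerProduct.tailConst 2) ≤ B₀ := Real.exp_le_exp.2 (by linarith)
  -- the summed-error quantity
  set E : ℝ := ∑ l ∈ Finset.Ico 1 (D ^ 4), ‖nu χ l‖ / l *
    ∑ q ∈ l.divisorsAntidiagonal, (q.1.divisors.card : ℝ) * ‖nuOneStar c' χ q.2‖ with hEdef
  have hE0 : 0 ≤ E := Finset.sum_nonneg fun l _ => mul_nonneg (by positivity)
    (Finset.sum_nonneg fun q _ => by positivity)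
  -- termwise
  have hterm : ∀ l ∈ Finset.Ico 1 (D ^ 4), ∀ q ∈ l.divisorsAntidiagonal,
      ‖∑' m₁ : ℕ, if ¬ Nat.Coprime m₁ (frakq D) then
          bcoef D (q.1 * m₁) * χ ((q.1 * m₁ : ℕ) : ZMod D) * nuOneStar c' χ q.2 *
            kappa2bar c' D m₁ / (m₁ : ℂ) else 0‖ ≤
        Cb * 24 * B₀ * (alpha D * ell D) * ((q.1.divisors.card : ℝ) * ‖nuOneStar c' χ q.2‖) := by
    intro l hl q hql
    have hq' := Nat.mem_divisorsAntidiagonal.1 hql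
    have hq1 : 1 ≤ q.1 := Nat.pos_of_ne_zero fun h0 => hq'.2 (by rw [← hq'.1, h0, zero_mul])
    have h1 := norm_tsum_R2_le χ c' hℓ3 hq1 q.2
    have h2 := sum_notCoprime_tau_kappa_le (-(b1 c' D)) D ⌈bigP D⌉₊ q.1
    have hν0 : 0 ≤ ‖nuOneStar c' χ q.2‖ := norm_nonneg _
    have hτ0 : 0 ≤ tau 2 q.1 := tau_nonneg _ _
    calc _ ≤ Cb * ‖nuOneStar c' χ q.2‖ * ∑ m ∈ (Icc 1 ⌈bigP D⌉₊).filter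
            (fun m => ¬ Nat.Coprime m (frakq D)), tau 2 (q.1 * m) * ‖kappa₂ (-(b1 c' D)) m‖ / m := h1
      _ ≤ Cb * ‖nuOneStar c' χ q.2‖ * (tau 2 q.1 * (2 * |-(b1 c' D)| *
            (Real.log ((D ^ 4 : ℕ) : ℝ) + Real.log 4)) *
            Real.exp (1 + 2 * |-(b1 c' D)| * (Real.log (⌈bigP D⌉₊ : ℝ) + Real.log 4) +
              LogEulerProduct.tailConst 2)) :=
          mul_le_mul_of_nonneg_left h2 (mul_nonneg hCb0 hν0)
      _ ≤ Cb * ‖nuOneStar c' χ q.2‖ * (tau 2 q.1 * (24 * (alpha D * ell D)) * B₀) := by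
          gcongr
      _ = Cb * 24 * B₀ * (alpha D * ell D) * (tau 2 q.1 * ‖nuOneStar c' χ q.2‖) := by ring
      _ = _ := by rw [tau_two_apply]
  -- sum up
  have hmain : ‖∑ l ∈ Finset.Ico 1 (D ^ 4), nu χ l / (l : ℂ) *
      ∑ q ∈ l.divisorsAntidiagonal, ∑' m₁ : ℕ,
        if ¬ Nat.Coprime m₁ (frakq D) then
          bcoef D (q.1 * m₁) * χ ((q.1 * m₁ : ℕ) : ZMod D) * nuOneStar c' χ q.2 *
            kappa2bar c' D m₁ / (m₁ : ℂ) else 0‖ ≤ Cb * 24 * B₀ * (alpha D * ell D * E) := by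
    refine (norm_sum_le _ _).trans ?_
    rw [hEdef, Finset.mul_sum, Finset.mul_sum]
    refine Finset.sum_le_sum fun l hl => ?_
    rw [norm_mul, norm_div, Complex.norm_natCast]
    have hl0 : 0 ≤ ‖nu χ l‖ / (l : ℝ) := by positivity
    rw [show Cb * 24 * B₀ * (alpha D * ell D * (‖nu χ l‖ / l *
        ∑ q ∈ l.divisorsAntidiagonal, (q.1.divisors.card : ℝ) * ‖nuOneStar c' χ q.2‖)) =
        ‖nu χ l‖ / l * (Cb * 24 * B₀ * (alpha D * ell D) * ∑ q ∈ l.divisorsAntidiagonal,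
          ((q.1.divisors.card : ℝ) * ‖nuOneStar c' χ q.2‖)) by ring, Finset.mul_sum]
    refine mul_le_mul_of_nonneg_left ((norm_sum_le _ _).trans (Finset.sum_le_sum fun q hq =>
      hterm l hl q hq)) hl0
  calc _ ≤ Cb * 24 * B₀ * (alpha D * ell D * E) := hmain
    _ ≤ K * (alpha D * ell D * E) := by
        refine mul_le_mul_of_nonneg_right (by linarith) (mul_nonneg hαℓ hE0)
    _ ≤ K * (ε / K) := mul_le_mul_of_nonneg_left eE hK0.le
    _ = ε := by field_simp

end Literature.NumberTheory.LFunctions.Zhang2022.Phi3Eval
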